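import Literature.NumberTheory.EllipticCurves.Kato2004.AdditivePotGoodRankZeroShaUpperBound
import Literature.NumberTheory.EllipticCurves.KatoFineSelmerDual
import HarnessLib

/-!
# Kato 2004, Thm. 14.5 (3) ⊕ Prop. 14.16 (2) at an ADDITIVE, POTENTIALLY GOOD prime `p ≠ 2` with (12.5.2) replaced by «`E[p]` IRREDUCIBLE and the dual fine Selmer group of `E` over `ℚ^cyc` finitely generated over `ℤ_p`» (Coates–Sujatha's statement (A) at `(E, p)` as a HYPOTHESIS): the Tamagawa-exact rank-`0` upper bound `ord_p #Ш(E/ℚ)[p^∞] + v_p(Tam E) ≤ ord_p(L(E,1)/Ω_E)` (named fact; one reading, weaker than print)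

Topic `NumberTheory/EllipticCurves`, sub-directory `Kato2004` (namespace = path). ONE named fact
(`def … : Prop`, D-0014), nothing else. Sibling of the Tamagawa-exact reading
A161″ `Kato2004.rankZero_padicValNat_sha_add_padicValNat_tamagawa_le_of_additive_potGood_of_imageContainsSL2`
(file `Kato2004/AdditivePotGoodRankZeroShaUpperBound.lean`, whose module docstring carries the
verbatim statements of Thm. 14.5, Prop. 14.16, (12.5.2), §14.1, §14.8–14.10 and items 1–5 of the
derivation; not repeated here): SAME conclusion, SAME normalisations, the big-image hypothesis
(12.5.2) («`ρ_{E,p^∞}(Gal(ℚ̄/ℚ(ζ_{p^∞}))) ⊇ SL₂(ℤ_p)`») REPLACED by the conjunction of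
«`E[p]` is an irreducible `Gal(ℚ̄/ℚ)`-module» and «the Pontryagin dual of the fine Selmer group
`Sel₀(ℚ^cyc, E[p^∞])` is a finitely generated `ℤ_p`-module» — the latter being the statement that
Coates–Sujatha [CoatesSujatha2005] and Lim [Lim2017FineSelmer, §3] label "(A)" at `(E, p)` (unproved
in general; proved e.g. when `E` admits a `p`-isogeny, Wuthrich 2014 Lemma 14), carried as a
HYPOTHESIS of the fact — nothing about it is asserted here. Written by the
prover seat `bsd-potss-k8t-c4` (cell `bsd-potss`, rung K8-t′, item stmt-BirchSwinnertonDyer-19202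
`TameUpperNonsurjTower`: the rank-`0` (t′) rows with `E[p]` irreducible and `p`-adic tower image
NOT onto, where A161″ does not apply), to NAME the one quantity Kato's argument leaves uncontrolled
on those rows — the `μ`-invariant of `𝐇²(T)` on the trivial-character component — instead of an
amorphous "index error". Flag for the referee (reading audit wanted, lit-kato format):
`Kato-14.5(3)-14.16(2)-additive-potgood-reading-tamagawa-exact-irreducible-fineSelmer-fg`.

## The printed statements used beyond the sibling's (K. Kato, Astérisque 295 (2004); held copy `paper:doi-10-24033-ast-639`, pages re-read 2026-08-26)

* **12.2** (p. 220): "`𝐇^q(T) = lim_n H^q(ℤ[ζ_{p^n}, 1/p], T)` where `H^q` is the etale cohomology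
  as in 8.2, and the inverse limit is taken with respect to trace maps. … (12.2.1) `𝐇^q(T) = 0` if
  `q ≠ 1, 2` and `𝐇¹(T)` and `𝐇²(T)` are finitely generated `ℤ_p[[G_∞]]`-modules."
* **Thm. 12.4 (3)** (p. 221): "If `p ≠ 2` and if `T/𝔪_λT` is irreducible as a two dimensional
  representation of `Gal(ℚ̄/ℚ)` over `O_λ/𝔪_λ`, `𝐇¹(T)` is a free `Λ`-module of rank `1`."
* **Thm. 12.5 (3)** (p. 222, NO hypothesis on the image): "Let `𝔭` be a prime ideal of `Λ` of height
  one which does not contain `p`. Then `length_{Λ_𝔭}(𝐇²(V_{F_λ}(f))_𝔭) ≤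
  length_{Λ_𝔭}(𝐇¹(V_{F_λ}(f))_𝔭 / Z(f)_𝔭) + length_{Λ_𝔭}(𝐇²_loc(V_{F_λ}(f))_𝔭)`. If
  `𝐇²_loc(V_{F_λ}(f))_𝔭 ≠ 0`, then `f` and `𝔭` satisfy the following (12.5.1): `k = 2`, `f` is not
  potentially of good reduction at `p` (12.7), …" [so at a potentially good `p` the local term is `0`
  at every such `𝔭`]; proved for non-CM `f` in 13.13 ("The inequality in Thm. 12.5 (3) is a
  consequence of the inequality in Thm. 13.4 (2)") and for CM `f` in §15.
* **Thm. 12.5 (4)** (p. 222): under `p ≠ 2` and (12.5.2): "`Z(f,T) ⊂ 𝐇¹(T)`. Furthermore,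
  `length_{Λ_𝔭}(𝐇²(T)_𝔭) ≤ length_{Λ_𝔭}(𝐇¹(T)_𝔭/Z(f,T)_𝔭)` for any prime ideal `𝔭` of `Λ` of height
  one unless `f` and `𝔭` satisfy (12.5.1)"; and its PROOF **13.14** (p. 234): "Since
  `T = a·V_{O_λ}(f)` for some `a ∈ F_λ^×` under the assumption of Thm. 12.5 (4) (see 12.8), we may
  assume `T = V_{O_λ}(f)`. In this case, since `Z(f,T)/Z` is a finite group [Thm. 12.6], `Z(f,T)_𝔭 ⊂
  𝐇¹(T)_𝔭` for any prime ideal `𝔭` of `Λ` of height one. Since `𝐇¹(T)` is a free `Λ`-module under the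
  assumption of 12.5 (4) by 12.4 [(3)], this means `Z(f,T) ⊂ 𝐇¹(T)`. The inequality in Thm. 12.5 (4)
  follows from Thm. 13.4 (3)." — (12.5.2) enters ONLY through (a) the homothety of stable lattices
  (12.8) and (b) Thm. 13.4 (3) at the height-one primes CONTAINING `p`; (a) holds as soon as `T/𝔪T`
  is irreducible (tree theorem `WeierstrassCurve.exists_eq_pow_smul_of_galoisStable_of_hasIrreducibleModPGaloisRep`,
  `Kato2004/Condition1252.lean`, Kato's Remark 12.8 p. 223), and at the height-one primes NOT
  containing `p` the inequality is Thm. 12.5 (3) (Thm. 13.4 (2)), image-free.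
* **Thm. 12.6** (p. 222): "Let `T = V_{O_λ}(f)` (8.3). Let `Z` be the `Λ`-submodule of `𝐇¹(V_{O_λ}(f))`
  generated by [the integral zeta elements (1), (2)]. Then `Z ⊂ Z(f,T)` and `Z(f,T)/Z` is a finite
  group." (no image hypothesis).
* **Thm. 13.4** (p. 226), hypotheses of (2) = (i)–(v) with "(v) There exists an element `σ` of
  `Gal(ℚ̄/ℚ(ζ_{p^∞}))` such that `dim_L(Ker(1 − σ; T ⊗_{O_L} L → T ⊗_{O_L} L)) = 1`" and of (3) =
  "there exists an element `σ` of `Gal(ℚ̄/ℚ(ζ_{p^∞}))` such that `Coker(1 − σ : T → T)` is a free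
  `O_L`-module of rank 1, and … `T ⊗ O_L/𝔪_L` is irreducible … `p ≠ 2`"; "(2) Let `𝔭` be a prime ideal
  of `Λ` of height one which does not contain `p`. Then `length_{Λ_𝔭}(𝐇²(T)_{0,𝔭}) ≤ length_{Λ_𝔭}(Λ_𝔭/J_𝔭)`."
* **14.14, proof of Thm. 14.5 (3)** (p. 243): "Let `𝔭` be the kernel of the `O_λ`-homomorphism
  `Λ → O_λ` which sends `G_∞` to `1`. … Let `a` be a generator of `𝔭`. … we have an exact sequence
  (14.14.1) `0 → 𝐇¹(T)/a𝐇¹(T) → H¹(ℤ[1/p], T) → ₐ𝐇²(T) → 0` and an isomorphism (14.14.2)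
  `𝐇²(T)/a𝐇²(T) ≅ H²(ℤ[1/p], T)`. By Lemma 14.15 below which we apply by taking `Λ` as `A` and `𝐇²(T)`
  and `𝐇¹(T)/Z(f,T)` as `M`, we obtain from 12.5 (4) `#(𝐇²(T)/a𝐇²(T))·#(ₐ𝐇²(T))⁻¹ ≤ [𝐇¹(T)/a𝐇¹(T) : z]`
  … Hence `#(H²(ℤ[1/p],T)) ≤ [H¹(ℤ[1/p],T) : z]`." — i.e. 14.5 (3) uses (12.5.2) ONLY through the
  conclusion of 12.5 (4); and **Lemma 14.15** (pp. 243–244): "[`M/aM`] − [`ₐM`] `= Σ_𝔮 length_{A_𝔮}(M_𝔮)·[A/(𝔮 + aA)]`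
  in `G(C)`, where `𝔮` ranges over all prime ideals of `A` of height one which do not contain `a`"
  (for `A = Λ = ∏_χ O_λ[[T]]`, `a = (1,…,1,T)`: the `χ ≠ 1` primes contribute `[0]`, and among the
  `χ = 1` primes the prime `(ϖ)` contributes `μ(M_{χ=1})·[O_λ/(ϖ,T)]` — so the comparison of `𝐇²(T)`
  with `𝐇¹(T)/Z(f,T)` needs the length inequality at the TRIVIAL-CHARACTER height-one primes only,
  INCLUDING `(ϖ) = (p)`: `μ(𝐇²(T)_1) ≤ μ((𝐇¹(T)/Z(f,T))_1)`, where `M_1 = e_1 M`, `e_1` the idempotent of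
  the trivial character of `Δ = Gal(ℚ(ζ_p)/ℚ)`, `p ∤ #Δ`).

M. F. Lim, *Notes on the fine Selmer groups*, Asian J. Math. 21 (2017) 337–362 = arXiv:1306.2047
[Lim2017FineSelmer], §2–§3 (held copy `paper:arxiv-1306.2047`): with `R_S(W/𝓛) = ker(H¹(G_S(𝓛), W) →
⊕_{v∈S} K¹_v(W/𝓛))` the fine Selmer group and `Y_S(T/𝓛)` its Pontryagin dual, "It follows from the
Poitou–Tate sequence that we have the following exact sequence `0 → Y_S(T/𝓛) → lim_L H²(G_S(L), T) →
(⊕_{v∈S} K⁰_v(W/𝓛))^∨ → W(𝓛)^∨ → 0` … we shall write `H²_S(𝓛/F, T) = lim_L H²(G_S(L), T)`" (§2);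
**statement (A)** (§3, "[CS]" = Coates–Sujatha, Math. Ann. 331 (2005) [CoatesSujatha2005]; Lim: "we
claim that the following stronger statement should hold. (A) For any number field `F`, `Y_S(T/F^cyc)`
is a finitely generated `R`-module"); and the §3 lemma "(Compare with
[CS]) `Y_S(T/F^cyc)` is finitely generated over `R` if and only if `H²_S(F^cyc/F, T)` is finitely
generated over `R`. From the Poitou–Tate sequence, `0 → Y_S(T/F^cyc) → H²_S(F^cyc/F, T) →
(⊕_{v∈S} K⁰_v(W/F^cyc))^∨`, [and] `K⁰_v(W/F^cyc) ≅ ⊕_{w∣v} W(F^cyc_w)`" [each `W(F^cyc_w) = E[p^∞](ℚ^cyc_w)`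
has `ℤ_p`-corank `≤ 2` and there are finitely many `w ∣ v`, so the right-hand term is `ℤ_p`-finitely
generated].

C. Wuthrich, Doc. Math. 19 (2014) [Wuthrich2014], the printed PRECEDENT of the mechanism in the
REDUCIBLE case: **Lemma 14** "Let `E` be an elliptic curve and `p` an odd prime such that `E` admits
an isogeny of degree `p`. Then the fine Selmer group `Y(E)` is a finitely generated `ℤ_p`-module" and
**Prop. 15** (proof): "Since the representation `ρ_p` is not surjective, the Euler system argument
gives us only a divisibility of the form [`char_Λ(Y(E))·J' ∣ J·λΛ`] for some ideal `J` of `Λ` which is a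
product of primes containing `p`, see Theorem 2.3.4 in [Rubin] or Theorem 13.4 in [Kato]. … The
previous lemma shows that `char_Λ(Y(E))` is not divisible by any prime ideal containing `p`, so the
proposition follows".

## The derivation (items 1–5 of the sibling A161″ unchanged; its uses of (12.5.2) replaced)

The sibling's docstring records that (12.5.2) is used three times: (α) in Thm. 14.5 (3) (`μ ≥ 1`),
(β) for the `H⁰` factors `#E(ℚ)[p^∞] = 1` of Prop. 14.16 (2), (γ) for `E(ℚ)[p] = 0` in Greenberg's
Cassels theorem (Prop. 4.13). (β) and (γ) need only `E(ℚ)[p] = 0`, which follows from the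
irreducibility of `E[p]`. For (α): take `T = T_pE` (`≅ V_{ℤ_p}(f_E)(1)` up to homothety — all stable
lattices of `V_pE` are `p^n T` when `E[p]` is irreducible), `p ≠ 2`.
6. `𝐇¹(T)` is free of rank one (12.4 (3)) and `Z(f,T) ⊂ 𝐇¹(T)` (13.14 verbatim: 12.6 + 12.4 (3) +
   homothety; no use of `SL₂(ℤ_p)`).
7. At every height-one `𝔭 ∌ p`: `length_𝔭 𝐇²(T)_𝔭 ≤ length_𝔭 (𝐇¹(T)/Z(f,T))_𝔭` — Thm. 12.5 (3)
   (`𝐇(T) ⊗ ℚ = 𝐇(V)`, `p` is a unit in `Λ_𝔭`; the local term vanishes at a potentially good `p`).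
8. At the trivial-character height-one prime containing `p`: `𝐇²(T)_1 = lim_n H²(ℤ_n-ring[1/p], T)`
   over the cyclotomic `ℤ_p`-extension `ℚ^cyc = ∪ ℚ_n` (`p ∤ #Δ`, so `e_1` is exact and
   `e_1 H²(ℤ[ζ_{p^{n+1}},1/p], T) = H²(O_{ℚ_n}[1/p], T)`); Kato's `H²(O_{ℚ_n}[1/p], j_*T)` (8.2) maps to
   `H²(G_S(ℚ_n), T)` (`S` = bad primes `∪ {p}`) with kernel and cokernel controlled by
   `⊕_{w ∣ ℓ ∈ S∖{p}} H^{0,1}(k(w), H¹(I_w, T))` (Leray for `j : Spec O[1/S] → Spec O[1/p]`,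
   `R²j_* = 0` at `w ∤ p`), finitely many `w` over each `ℓ ≠ p` in `ℚ^cyc` and each term of
   `ℤ_p`-rank `≤ 2`: so `𝐇²(T)_1` is `ℤ_p`-finitely generated iff `H²_S(ℚ^cyc/ℚ, T)` is, iff (Lim's
   lemma) `Y_S(T/ℚ^cyc) = X₀(E/ℚ^cyc)` is — the HYPOTHESIS `hA` (statement (A) at `(E,p)`). A finitely
   generated `ℤ_p`-module has `μ = 0`, so `length_{(p)}(𝐇²(T)_{1,(p)}) = 0 ≤ length_{(p)}((𝐇¹(T)/Z(f,T))_{1,(p)})`.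
9. Items 7–8 are exactly the input of 14.14/Lemma 14.15 on the trivial-character component (the
   displayed formula of 14.15 with `a = (1,…,1,T)`), whence `#H²(ℤ[1/p],T) ≤ [H¹(ℤ[1/p],T) : z]`
   (`μ ≥ 1` in the sibling's item 2), and items 1–5 of the sibling run unchanged:
   `ord_p #Ш(E/ℚ)[p^∞] + Σ_ℓ v_p(c_ℓ) ≤ ord_p(L(E,1)/Ω(W))`.

WHAT IS NOT CLAIMED. Statement (A) is NOT asserted (hypothesis `hA` below); nothing at `p = 2`; nothing
at a potentially multiplicative `p` (12.5.1); no lower bound; no statement that the hypothesis is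
weaker than (12.5.2) (under (12.5.2) Kato proves the INEQUALITY of `μ`-invariants, 13.4 (3), not
`μ(𝐇²) = 0`: the two readings are incomparable). The non-verbatim steps are the sibling's items 2–4
and items 6–9 above, each a printed theorem applied to `T_pE`; the comparison in item 8 between
Kato's `j_*`-cohomology and `H²(G_S)` is the standard Leray sequence (Milne, *Étale Cohomology*,
III.1.18 (a), as already used in the sibling's item 4 (a)).

THE LEAN STATEMENT AND ITS NORMALISATION. As the sibling (`W` globally minimal, `Ω(W) =
W.realPeriodRat`, additive = `¬ good ∧ ¬ multiplicative`, potentially good = `0 ≤ ord_p j(W)`,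
`Ш` finite = `Finite W.sha`), with `Kato2004.ImageContainsSL2 W p` REPLACED by
`W.HasIrreducibleModPGaloisRep p` and the HYPOTHESIS `hA`: for every `ℤ_p`-extension `κ` of `ℚ` that
is cyclotomic (`κ.IsCyclotomic`; over `ℚ` every `ℤ_p`-extension is) there are `γ` and a Pontryagin-dual
datum `D : W.FineSelmerDualData κ γ` of `Sel₀(ℚ^cyc, E[p^∞])` (tree structure, file
`KatoFineSelmerDual.lean`: `D.X ≃ Hom(Sel₀(ℚ^cyc, E[p^∞]), ℚ/ℤ)` with its `Λ`-action) whose underlying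
`ℤ_p`-module is finitely generated (`Module.Finite ℤ_[p] (RestrictScalars ℤ_[p] (IwasawaAlgebra p) D.X)`,
the tree's spelling of "`μ = 0`", cf. `muInvariant_eq_zero_iff`). Since `Sel₀` is `p`-primary and
`toDual` is bijective with the constants acting through `ℤ_p → ℤ/p^k` (`toDual_C_smul`), the
`ℤ_p`-module underlying ANY such datum is `Hom(Sel₀(ℚ^cyc, E[p^∞]), ℚ/ℤ)` with its natural action, so
the hypothesis says exactly "`Y(E/ℚ^cyc)` is a finitely generated `ℤ_p`-module" — statement (A)
of [CoatesSujatha2005] at `(E, p)` — in the existential (strongest-as-hypothesis) form. Weaker than print in every other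
respect; never stronger; no `_holds` (size XL: Kato's Euler system, explicit reciprocity,
Poitou–Tate). Consumer: `Summits/BirchSwinnertonDyer/BirchSwinnertonDyer/Theorems/KatoDescentTamePotSupersingularTameUpperNonsurjTowerFineSelmer.lean`.

## References

* K. Kato, Astérisque 295 (2004): 8.2 (pp. 180–181), 12.2 (p. 220), Thm. 12.4 (3) (p. 221), Thm.
  12.5 (3), (4), (12.5.1), (12.5.2) (p. 222), Thm. 12.6 (p. 222), Remark 12.8 (p. 223), Thm. 13.4
  (p. 226), 13.7 (p. 227), 13.13–13.14 (pp. 233–234), Thm. 14.5 (pp. 236–237), §14.8 (p. 238),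
  14.14 and Lemma 14.15 (pp. 243–244), Prop. 14.16 (p. 244). [Kato2004Asterisque]
* J. Coates, R. Sujatha, Math. Ann. 331 (2005) 809–839, statement (A) of the introduction / §3. [CoatesSujatha2005]
* M. F. Lim, Asian J. Math. 21 (2017) 337–362 = arXiv:1306.2047, §2 (Poitou–Tate sequence for
  `Y_S`), §3 (statement (A); the lemma "`Y_S(T/F^cyc)` f.g. over `R` iff `H²_S(F^cyc/F,T)` f.g. over
  `R`"). [Lim2017FineSelmer]
* C. Wuthrich, Doc. Math. 19 (2014) 381–402, Lemma 14, Prop. 15. [Wuthrich2014]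
* R. Greenberg, LNM 1716 (1999), Prop. 4.13; §3 after Lemma 3.3. [GreenbergLNM1716]
* C.-H. Kim, Amer. J. Math. 148 (2026), §3.2.3 display before Thm. 3.7. [Kim2022StructureSelmer]
* K. Rubin, *Euler systems and modular elliptic curves*, in LMS Lecture Note Ser. 254 (1998), Thm.
  4.1 (ii) ("there is a nonnegative integer `t` such that `char(X_∞)` divides `p^t 𝓛`"). [Rubin2000EulerSystems]
-/

noncomputable section

open scoped Classical

namespace Literature.NumberTheory.EllipticCurves.Kato2004

open WeierstrassCurve

/-- **Kato's Euler-system bound at an additive, potentially good prime `p ≠ 2`, in analytic rank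
`0`, TAMAGAWA-EXACT, for IRREDUCIBLE `E[p]` of ANY image size, GRANTED the finite generation over
`ℤ_p` of the dual fine Selmer group `Y(E/ℚ^cyc)` (Coates–Sujatha's statement (A) at `(E,p)`, a
HYPOTHESIS here): `ord_p #Ш(E/ℚ)[p^∞] + v_p(∏_ℓ c_ℓ) ≤ ord_p(L(E,1)/Ω_E)`.** Sources: K. Kato, Astérisque 295
(2004) — the sibling A161″'s chain (**Thm. 14.5 (3)** p. 236 via its proof **14.14 + Lemma 14.15**
pp. 243–244, which uses (12.5.2) only through the conclusion of Thm. 12.5 (4); **Prop. 14.16 (2)**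
p. 244; §14.8; Greenberg LNM 1716 Prop. 4.13; Kim AJM 148 §3.2.3) with the conclusion of 12.5 (4)
obtained WITHOUT (12.5.2) from **Thm. 12.4 (3)** (p. 221: `𝐇¹(T)` free for `p ≠ 2`, `T/𝔪T`
irreducible), **13.14** (p. 234: `Z(f,T) ⊂ 𝐇¹(T)` from Thm. 12.6 + freeness + homothety of stable
lattices, the latter from irreducibility, Remark 12.8), **Thm. 12.5 (3)** (p. 222: the length
inequality at every height-one `𝔭 ∌ p`, NO image hypothesis, local term `0` at a potentially good `p`)
and, at the trivial-character height-one prime containing `p`, the vanishing `μ(𝐇²(T)_1) = 0` that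
follows from the HYPOTHESIS that the dual fine Selmer group `Y(E/ℚ^cyc)` is `ℤ_p`-finitely generated
(M. F. Lim, Asian J. Math. 21 (2017) §3: `Y_S(T/F^cyc)` f.g. over `ℤ_p` iff `H²_S(F^cyc/F,T)` is, by
Poitou–Tate; Kato 12.2/8.2 and the Leray sequence for the comparison with `𝐇²(T)_1`) — the
statement (A) of Coates–Sujatha (Math. Ann. 331 (2005)) at `(E,p)`, carried as the binder `hA` and
NOT asserted here. Printed precedent of the
mechanism: Wuthrich, Doc. Math. 19 (2014) Lemma 14 + Prop. 15 (reducible `E[p]`). Let `W/ℚ` be a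
globally minimal elliptic curve and `p ≠ 2` a prime at which `W` has ADDITIVE and POTENTIALLY GOOD
reduction; assume `E[p]` irreducible (`W.HasIrreducibleModPGaloisRep p`), `L(E,1) ≠ 0`, `Ш(E/ℚ)`
finite, and (`hA`) that for every cyclotomic `ℤ_p`-extension datum `κ` of `ℚ` some Pontryagin-dual
datum `D` of `Sel₀(ℚ^cyc, E[p^∞])` (`W.FineSelmerDualData κ γ`) has `ℤ_p`-finitely generated
underlying module. Then there is `q ∈ ℚ` with `L(E,1)/Ω(W) = q` and
`ord_p #Ш(E/ℚ)(p) + v_p(Tam(W)) ≤ ord_p q`. Weaker than print; never stronger; no `_holds` (size XL).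
Flag for the referee: `Kato-14.5(3)-14.16(2)-additive-potgood-reading-tamagawa-exact-irreducible-fineSelmer-fg`
(see the module docstring, items 6–9, for the non-verbatim steps).
[cite: Kato2004Asterisque, Thm. 12.4 (3) (p. 221), Thm. 12.5 (3)–(4) (p. 222), Thm. 12.6 (p. 222), Remark 12.8 (p. 223), Thm. 13.4 (p. 226), 13.14 (p. 234), Thm. 14.5 (3) (p. 236), 14.14 and Lemma 14.15 (pp. 243–244), Prop. 14.16 (2) (p. 244), §14.8 (p. 238), 12.2 (p. 220)]
[cite: Lim2017FineSelmer, §2 (Poitou–Tate sequence for Y_S), §3 (statement (A) and the lemma «Y_S(T/F^cyc) f.g. over R iff H²_S(F^cyc/F,T) f.g. over R»)]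
[cite: CoatesSujatha2005, statement (A) (introduction and §3)]
[cite: Wuthrich2014, Lemma 14, Prop. 15]
[cite: GreenbergLNM1716, Prop. 4.13 and the paragraph following its proof, §4; §3, paragraph after Lemma 3.3]
[cite: Kim2022StructureSelmer, §3.2.3 display before Thm. 3.7 (PDF p. 16)] -/
def rankZero_padicValNat_sha_add_padicValNat_tamagawa_le_of_additive_potGood_of_irreducible_of_fineSelmerDual_fg :
    Prop :=
  ∀ (W : WeierstrassCurve ℚ) [W.IsElliptic] [W.IsGloballyMinimal] (p : ℕ) [Fact p.Prime],
    p ≠ 2 →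
    ¬ W.HasGoodReductionAtPrime p → ¬ W.HasMultiplicativeReductionAtPrime p →
    0 ≤ padicValRat p W.j →
    W.HasIrreducibleModPGaloisRep p →
    (∀ (κ : ZpExtension ℚ p), κ.IsCyclotomic →
      ∃ (γ : Field.absoluteGaloisGroup ℚ) (D : W.FineSelmerDualData κ γ),
        Module.Finite ℤ_[p] (RestrictScalars ℤ_[p] (IwasawaAlgebra p) D.X)) →
    W.entireLFunction 1 ≠ 0 → Finite W.sha →
    ∃ q : ℚ, W.entireLFunction 1 / (W.realPeriodRat : ℂ) = (q : ℂ) ∧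
      (padicValNat p (Nat.card (AddCommGroup.primaryComponent W.sha p)) : ℤ) +
          padicValNat p W.tamagawaProduct ≤ padicValRat p q

end Literature.NumberTheory.EllipticCurves.Kato2004

end
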